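import Literature.Computability.Complexity.BoundedMajoritySearch
import Literature.Computability.Complexity.TM2While
import HarnessLib

/-!
# Bounded quantifiers at polynomial overhead: `poly(N) · 2^{O(b)}` deciders for `BEX`, `BMAJ`

Literature / complexity toolkit (machine level, TM2 model), the FINE-GRAINED companion of
`NondeterministicKannanSearch.lean` (`NKannan.DecIn.bex`) and `BoundedMajoritySearch.lean`
(`NKannan.DecIn.bmaj`). Those deciders of the bounded quantifiers

  `BEX k β A = {w | ∃ y ∈ {0,1}^{β n}, ⟨w, y⟩ ∈ A}`,
  `BMAJ k β A = {w | #{y ∈ {0,1}^{β n} | ⟨w, y⟩ ∈ A} > 2^{β n}/2}`   (`n = |fstP^[k] w|`)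

cost `bexCost c β t n N = 2^{c (N + β n + 1)} · (t + 1)`: exponential in the WORD length `N`,
because the lister of `NKannan.exists_lister` clocks its loop with `2^{|state|}` ticks
(harmless for `E`, `EXP`, `DTIME(2^{2^{O(n)}})`, fatal below). Here the loop is the UNCLOCKED
`while` machine of `TM2While.lean` run on flagged states `f :: ⟨⟨w, y⟩, acc⟩` until the
successor of the numeral `y` carries out (`CoinEnum.carryFn`, exactly `2^b` rounds), and the
quantifier range `0^{β n}` is produced in POLYNOMIAL time (`NKannan.FPProducer β`: an `FP`
function `x ↦ 0^{β |x|}`), so that the whole search costs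

  `fineCost a p β t n N = 2^{a (β n + 1)} · p(N) · (t n (2N + 2 + β n) + 1)`

— polynomial in `N`, exponential only in the number `b = β n` of quantified bits. This is the
overhead the subexponential simulations need: with `b = n^{δ}` seeds and a `DTIME(2^{n^δ})`
matrix the majority vote is in `DTIME(2^{O(n^δ)})` (Impagliazzo–Wigderson 1998, §2.1;
Babai–Fortnow–Nisan–Wigderson 1993; Impagliazzo–Kabanets–Wigderson 2002, Thm. 12), and with
`b = O(log n)` it is polynomial (Arora–Barak 2009, Lemma 20.3).

## Contents

* `NKannan.PBnd b N Q` — bookkeeping predicate `Q ≤ 2^{a (b + 1)} · p(N)`, closed under `+`,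
  `·`, powers and polynomials (`PBnd.add/mul/pow/poly`), containing `N`, `b`, `2^{O(b)}`;
* `NKannan.FPProducer β` (`fpProducer_length` for `β = id`);
* the flagged round `NKannan.stepFlagFn ∈ FP` and its orbit `NKannan.wd` (`stepFlagFn_wd`),
  `NKannan.initFlagFn`, `NKannan.postAccFn`;
* **`NKannan.exists_lister_fine`** — the `none`-separated list of the `2^b` entries
  `⟨w, natBits b j⟩`, `j < 2^b`, within `2^{a (b+1)} · p(N)` steps;
* `NKannan.fineCost`, **`NKannan.DecIn.bmajFine`** and **`NKannan.DecIn.bexFine`**.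

## References

* S. Arora, B. Barak, *Computational Complexity: A Modern Approach*, CUP 2009, §7.1 (remark after
  Def. 7.3), proof of Lemma 20.3 ("try all seeds … majority … time `2^{O(ℓ(n))}`"), §2.1
  (exhaustive search over certificates), §1.3–1.4. [AroraBarakCC2009]
* R. Impagliazzo, A. Wigderson, *Randomness vs time: derandomization under a uniform
  assumption*, JCSS 63 (2001), §2.1. [ImpagliazzoWigderson2001]
-/

namespace Literature.Computability.Complexity

namespace NKannan

open _root_.Computability Turing Function Polynomial

/-! ### Bookkeeping: quantities `≤ 2^{O(b)} · poly(N)` -/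

section PBnd

variable {ι : Type} {b N : ι → ℕ}

/-- `PBnd b N Q`: the quantity `Q i` is at most `2^{a (b i + 1)} · p (N i)` for a constant `a` and
an `ℕ`-polynomial `p` — exponential in the quantifier range only, polynomial in the word length.
[folklore] -/
def PBnd (b N : ι → ℕ) (Q : ι → ℕ) : Prop :=
  ∃ (a : ℕ) (p : Polynomial ℕ), ∀ i, Q i ≤ 2 ^ (a * (b i + 1)) * p.eval (N i)

/-- Monotonicity. [folklore] -/
theorem PBnd.mono {Q Q' : ι → ℕ} (h : PBnd b N Q) (hle : ∀ i, Q' i ≤ Q i) : PBnd b N Q' := by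
  obtain ⟨a, p, hp⟩ := h
  exact ⟨a, p, fun i => (hle i).trans (hp i)⟩

/-- Constants. [folklore] -/
theorem PBnd.const (K : ℕ) : PBnd b N fun _ => K :=
  ⟨0, Polynomial.C K, fun i => by simp⟩

/-- The word length. [folklore] -/
theorem PBnd.self_N : PBnd b N N :=
  ⟨0, X, fun i => by simp⟩

/-- `2^{affine in b}`. [folklore] -/
theorem PBnd.two_pow (K : ℕ) {Q : ι → ℕ} (h : ∀ i, Q i ≤ K * b i + K) : PBnd b N fun i => 2 ^ Q i := by
  refine ⟨K, 1, fun i => ?_⟩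
  rw [eval_one, mul_one]
  exact Nat.pow_le_pow_right (by norm_num) ((h i).trans (by nlinarith))

/-- The quantifier range itself (`b ≤ 2^b`). [folklore] -/
theorem PBnd.self_b : PBnd b N b :=
  (PBnd.two_pow 1 (Q := b) fun i => by omega).mono fun i => (Nat.lt_two_pow_self).le

/-- Sums. [folklore] -/
theorem PBnd.add {Q Q' : ι → ℕ} (h : PBnd b N Q) (h' : PBnd b N Q') : PBnd b N fun i => Q i + Q' i := by
  obtain ⟨a, p, hp⟩ := h
  obtain ⟨a', p', hp'⟩ := h'
  refine ⟨a + a', p + p', fun i => ?_⟩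
  have e1 : 2 ^ (a * (b i + 1)) ≤ 2 ^ ((a + a') * (b i + 1)) :=
    Nat.pow_le_pow_right (by norm_num) (Nat.mul_le_mul_right _ (by omega))
  have e2 : 2 ^ (a' * (b i + 1)) ≤ 2 ^ ((a + a') * (b i + 1)) :=
    Nat.pow_le_pow_right (by norm_num) (Nat.mul_le_mul_right _ (by omega))
  rw [eval_add, Nat.mul_add]
  exact Nat.add_le_add ((hp i).trans (Nat.mul_le_mul_right _ e1))
    ((hp' i).trans (Nat.mul_le_mul_right _ e2))

/-- Products. [folklore] -/
theorem PBnd.mul {Q Q' : ι → ℕ} (h : PBnd b N Q) (h' : PBnd b N Q') : PBnd b N fun i => Q i * Q' i := by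
  obtain ⟨a, p, hp⟩ := h
  obtain ⟨a', p', hp'⟩ := h'
  refine ⟨a + a', p * p', fun i => ?_⟩
  rw [eval_mul, Nat.add_mul, pow_add]
  calc Q i * Q' i ≤ (2 ^ (a * (b i + 1)) * p.eval (N i)) * (2 ^ (a' * (b i + 1)) * p'.eval (N i)) :=
        Nat.mul_le_mul (hp i) (hp' i)
    _ = 2 ^ (a * (b i + 1)) * 2 ^ (a' * (b i + 1)) * (p.eval (N i) * p'.eval (N i)) := by ring

/-- Powers. [folklore] -/
theorem PBnd.pow {Q : ι → ℕ} (h : PBnd b N Q) : ∀ d : ℕ, PBnd b N fun i => Q i ^ d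
  | 0 => (PBnd.const 1).mono fun i => by simp
  | d + 1 => by
    simpa only [pow_succ] using (PBnd.pow h d).mul h

/-- A polynomial of a bounded quantity is bounded. [folklore] -/
theorem PBnd.poly (q : Polynomial ℕ) {Q : ι → ℕ} (h : PBnd b N Q) : PBnd b N fun i => q.eval (Q i) := by
  obtain ⟨c, d, hcd⟩ := exists_eval_le_mul_pow_add q
  exact (((PBnd.const c).mul (h.pow d)).add (PBnd.const c)).mono fun i => hcd _

end PBnd

/-! ### Polynomial-time producers of the quantifier range -/

section Producer

/-- `FPProducer β`: some `FP` function writes `0^{β |x|}` on input `x` (so `β` is polynomially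
bounded and polynomial-time computable in unary). [folklore] -/
def FPProducer (β : ℕ → ℕ) : Prop :=
  ∃ Z : List Bool → List Bool, Z ∈ FP ∧ ∀ x : List Bool, Z x = List.replicate (β x.length) false

/-- The identity range `β n = n` (`Kannan.zerosFn`). [folklore] -/
theorem fpProducer_length : FPProducer fun n => n :=
  ⟨Kannan.zerosFn, Kannan.zerosFn_mem_FP, Kannan.zerosFn_apply⟩

/-- An `FP`-produced range is polynomially bounded. [folklore] -/
theorem FPProducer.exists_le {β : ℕ → ℕ} (h : FPProducer β) :
    ∃ p : Polynomial ℕ, ∀ n, β n ≤ p.eval n := by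
  obtain ⟨Z, ⟨p, M, hM⟩, hZ⟩ := h
  refine ⟨X + Polynomial.C (TM2Comp.machinePushBound M.tm) * p, fun n => ?_⟩
  have h1 := (hM (List.replicate n false)).length_le
  simp only [id_eq, hZ, List.length_replicate] at h1
  simpa only [eval_add, eval_mul, eval_C, eval_X] using h1

end Producer

/-! ### The flagged round and its orbit -/

section Round

/-- The round of the fine lister on flagged states:
`f :: ⟨⟨w, y⟩, acc⟩ ↦ [carry(y+1)] ++ ⟨⟨w, y + 1⟩, acc ++ ⟨⟨w, y⟩, ε⟩⟩` — the flag raised by the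
round is the carry out of the successor, i.e. `1` exactly after the last numeral `1^b`.
[folklore] -/
noncomputable def stepFlagFn : List Bool → List Bool :=
  fun z => CoinEnum.carryFn (sndP (fstP z.tail)) ++ roundFn z.tail

/-- The flagged round is in `FP`. [folklore] -/
theorem stepFlagFn_mem_FP : stepFlagFn ∈ FP :=
  append_mem_FP (comp_mem_FP CoinEnum.carryFn_mem_FP
    (comp_mem_FP sndP_mem_FP (comp_mem_FP fstP_mem_FP PRelSigma.tail_mem_FP)))
    (comp_mem_FP roundFn_mem_FP PRelSigma.tail_mem_FP)

/-- The flag after `i` rounds: `0` initially, then the carry out of the `i`-th successor.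
[folklore] -/
def flagAt (b : ℕ) : ℕ → Bool
  | 0 => false
  | i + 1 => TokConv.co true (natBits b i)

/-- The orbit of the flagged round: `wd w b i = flagAt b i :: stW w b i`. [folklore] -/
def wd (w : List Bool) (b i : ℕ) : List Bool :=
  flagAt b i :: stW w b i

/-- One flagged round advances the orbit. [folklore] -/
theorem stepFlagFn_wd (w : List Bool) (b i : ℕ) : stepFlagFn (wd w b i) = wd w b (i + 1) := by
  rw [wd, stepFlagFn, List.tail_cons, roundFn_stW, wd, flagAt]
  simp only [stW, fstP_boolPair, sndP_boolPair, CoinEnum.carryFn_apply, List.singleton_append]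

/-- Length of the orbit words. [folklore] -/
theorem length_wd (w : List Bool) (b i : ℕ) :
    (wd w b i).length = (i + 1) * (2 * (2 * w.length + 2 + b) + 2) + 1 := by
  rw [wd, List.length_cons, length_stW]

/-- Before the wrap-around the flag stays down. [folklore] -/
theorem flagAt_of_lt {b i : ℕ} (hi : i + 1 < 2 ^ b) : flagAt b (i + 1) = false :=
  CoinEnum.co_natBits_of_lt hi

/-- At the wrap-around (`2^b` rounds) the flag is raised. [folklore] -/
theorem flagAt_two_pow (b : ℕ) : flagAt b (2 ^ b) = true := by
  have h : 2 ^ b = (2 ^ b - 1) + 1 := (Nat.sub_add_cancel Nat.one_le_two_pow).symm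
  rw [h]
  exact CoinEnum.co_natBits_last b

/-- The initial flagged state `0 :: ⟨⟨w, 0^b⟩, ε⟩ = wd w b 0` as an `FP` function of `w`, given
an `FP` producer `Z` of `0^{β |x|}` applied to the core `x = fstP^[k] w`. [folklore] -/
noncomputable def initFlagFn (k : ℕ) (Z : List Bool → List Bool) : List Bool → List Bool :=
  List.cons false ∘ fanoutFn (fanoutFn (fun w => w) (Z ∘ (fstP^[k]))) (fun _ => [])

/-- `initFlagFn ∈ FP`. [folklore] -/
theorem initFlagFn_mem_FP (k : ℕ) {Z : List Bool → List Bool} (hZ : Z ∈ FP) :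
    initFlagFn k Z ∈ FP :=
  comp_mem_FP (cons_mem_FP false) (fanoutFn_mem_FP (fanoutFn_mem_FP (PolyTimeComputable.id _)
    (comp_mem_FP hZ (iterate_fstP_mem_FP k))) (const_mem_FP _))

/-- Value of `initFlagFn`. [folklore] -/
theorem initFlagFn_apply (k : ℕ) {β : ℕ → ℕ} {Z : List Bool → List Bool}
    (hZ : ∀ x : List Bool, Z x = List.replicate (β x.length) false) (w : List Bool) :
    initFlagFn k Z w = wd w (β (fstP^[k] w).length) 0 := by
  simp only [initFlagFn, comp_apply, fanoutFn_apply, hZ, wd, flagAt, stW, accW,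
    CoinEnum.natBits_zero, List.range_zero, List.flatMap_nil]

/-- The projection of the final flagged state onto the accumulator: drop the flag, take the
second component. [folklore] -/
noncomputable def postAccFn : List Bool → List Bool := sndP ∘ List.tail

/-- `postAccFn ∈ FP`. [folklore] -/
theorem postAccFn_mem_FP : postAccFn ∈ FP := comp_mem_FP sndP_mem_FP PRelSigma.tail_mem_FP

/-- Value of `postAccFn` on the orbit. [folklore] -/
theorem postAccFn_wd (w : List Bool) (b i : ℕ) : postAccFn (wd w b i) = accW w b i := by
  simp [postAccFn, wd, stW]

end Round

/-! ### The fine lister -/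

section Lister

/-- `c n^d + c` is monotone in `n`. [folklore] -/
private theorem mul_pow_add_mono (c d : ℕ) {m n : ℕ} (h : m ≤ n) : c * m ^ d + c ≤ c * n ^ d + c :=
  Nat.add_le_add_right (Nat.mul_le_mul_left _ (Nat.pow_le_pow_left h d)) c

/-- **The fine lister.** For an `FP` producer of `β` there is a machine which, on any word `w`
with core `x = fstP^[k] w` of length `n` and `b = β n`, writes the `none`-separated list of the
`2^b` words `⟨w, natBits b j⟩`, `j < 2^b` (every `y ∈ {0,1}^b` exactly once), within
`2^{a (b + 1)} · p(|w|)` steps. Pipeline: `initFlagFn` (`FP`), the `while` machine of the flagged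
round `stepFlagFn` (`TM2While.whileAux_outputsWithin`, `2^b` rounds, stop on the carry flag),
`postAccFn` (`FP`), `transT` (transcoding the accumulator to the `none`-separated list).
[cite: AroraBarakCC2009, §2.1 (exhaustive search over all certificates) and §1.3–1.4] -/
theorem exists_lister_fine (k : ℕ) {β : ℕ → ℕ} (hβ : FPProducer β) :
    ∃ (T : List Bool → ℕ) (M₁ : TM2ComputableAux Bool (Option Bool)),
      PBnd (fun w => β (fstP^[k] w).length) (fun w => w.length) T ∧
      ∀ w : List Bool, M₁.OutputsWithin w
        ((List.range (2 ^ β (fstP^[k] w).length)).flatMap fun j =>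
          (boolPair w (natBits (β (fstP^[k] w).length) j)).map some ++ [none]) (T w) := by
  classical
  obtain ⟨Z, hZ, hZv⟩ := hβ
  obtain ⟨p₁, M1, hM1⟩ := exists_outputsWithin_of_mem_FP (initFlagFn_mem_FP k hZ)
  obtain ⟨pF, MF, hMF⟩ := exists_outputsWithin_of_mem_FP stepFlagFn_mem_FP
  obtain ⟨p₇, M7, hM7⟩ := exists_outputsWithin_of_mem_FP postAccFn_mem_FP
  obtain ⟨M8, hM8⟩ := transT.exists_outputsWithin
  obtain ⟨cF, dF, hcdF⟩ := exists_eval_le_mul_pow_add pF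
  let M₁ : TM2ComputableAux Bool (Option Bool) :=
    ((M1.comp (TM2While.whileAux MF id)).comp M7).comp M8
  -- quantities
  let n : List Bool → ℕ := fun w => (fstP^[k] w).length
  let b : List Bool → ℕ := fun w => β (n w)
  let E : List Bool → ℕ := fun w => 2 * (2 * w.length + 2 + b w) + 2
  let R : List Bool → ℕ := fun w => 2 ^ b w
  let B : List Bool → ℕ := fun w => (R w + 1) * E w + 1
  -- total time, last stage first
  let T : List Bool → ℕ := fun w =>
    ((transT.maxEmit + 1) * (R w * E w) + 3) +
    (p₇.eval (B w) +
    (R w * ((cF * B w ^ dF + cF) + 2 * B w + 2) +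
    p₁.eval w.length))
  have hT : PBnd b (fun w => w.length) T := by
    have bc : ∀ K, PBnd b (fun w : List Bool => w.length) fun _ => K := fun K => PBnd.const K
    have bN : PBnd b (fun w : List Bool => w.length) fun w => w.length := PBnd.self_N
    have bb : PBnd b (fun w : List Bool => w.length) b := PBnd.self_b
    have bE : PBnd b (fun w : List Bool => w.length) E :=
      ((bc 2).mul (((bc 2).mul bN).add (bc 2) |>.add bb)).add (bc 2)
    have bR : PBnd b (fun w : List Bool => w.length) R := PBnd.two_pow 1 fun w => by simp only [b]; omega
    have bB : PBnd b (fun w : List Bool => w.length) B := ((bR.add (bc 1)).mul bE).add (bc 1)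
    refine (((bc _).mul (bR.mul bE)).add (bc 3)).add ?_
    refine (PBnd.poly p₇ bB).add ?_
    refine (bR.mul (((((bc cF).mul (bB.pow dF)).add (bc cF)).add ((bc 2).mul bB)).add (bc 2))).add ?_
    exact PBnd.poly p₁ bN
  refine ⟨T, M₁, hT, fun w => ?_⟩
  have hR1 : 1 ≤ R w := Nat.one_le_two_pow
  -- 1. the initial flagged state
  have h1 : M1.OutputsWithin w (wd w (b w) 0) (p₁.eval w.length) := by
    have := hM1 w
    rwa [initFlagFn_apply k hZv] at this
  -- 2. the loop: `2^b` rounds of the flagged round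
  have h2 : (TM2While.whileAux MF id).OutputsWithin (wd w (b w) 0) (wd w (b w) (R w))
      (R w * ((cF * B w ^ dF + cF) + 2 * B w + 2)) := by
    have hlen : ∀ i ≤ R w, (wd w (b w) i).length ≤ B w := fun i hi => by
      rw [length_wd]
      exact Nat.add_le_add_right (Nat.mul_le_mul_right _ (by omega)) 1
    have H := TM2While.whileAux_outputsWithin MF id (R w - 1) (wd w (b w))
      (fun _ => cF * B w ^ dF + cF) (fun i hi => ?_) (fun i hi => ?_) ?_
    · rw [Nat.sub_add_cancel hR1] at H
      have hsum : ∑ i ∈ Finset.range (R w), (cF * B w ^ dF + cF + 2 * (wd w (b w) (i + 1)).length + 2)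
          ≤ ∑ _i ∈ Finset.range (R w), ((cF * B w ^ dF + cF) + 2 * B w + 2) :=
        Finset.sum_le_sum fun i hi => by
          have := hlen (i + 1) (Finset.mem_range.1 hi)
          omega
      rw [Finset.sum_const, Finset.card_range, smul_eq_mul] at hsum
      exact H.mono hsum
    · -- one round: `pF(|wd i|) ≤ cF B^dF + cF`
      have hrun := hMF (wd w (b w) i)
      rw [stepFlagFn_wd] at hrun
      exact hrun.mono ((hcdF _).trans (mul_pow_add_mono cF dF (hlen i (by omega))))
    · refine ⟨flagAt (b w) (i + 1), stW w (b w) (i + 1), rfl, ?_⟩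
      exact flagAt_of_lt (by simp only [R] at hi ⊢; omega)
    · refine ⟨flagAt (b w) (R w - 1 + 1), stW w (b w) (R w - 1 + 1), rfl, ?_⟩
      rw [Nat.sub_add_cancel hR1]
      exact flagAt_two_pow (b w)
  -- 3. projection onto the accumulator
  have h3 : M7.OutputsWithin (wd w (b w) (R w)) (accW w (b w) (R w)) (p₇.eval (B w)) := by
    have := hM7 (wd w (b w) (R w))
    rw [postAccFn_wd, length_wd] at this
    exact this
  -- 4. transcoding
  have h4 : M8.OutputsWithin (accW w (b w) (R w))
      ((List.range (R w)).flatMap fun j => (boolPair w (natBits (b w) j)).map some ++ [none])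
      ((transT.maxEmit + 1) * (R w * E w) + 3) := by
    have := hM8 (accW w (b w) (R w))
    rw [transT_eval_accW, length_accW] at this
    exact this
  exact TM2ComputableAux.comp_outputsWithin _ _ (TM2ComputableAux.comp_outputsWithin _ _
    (TM2ComputableAux.comp_outputsWithin _ _ h1 h2) h3) h4

end Lister

/-! ### The fine deciders -/

section Decider

/-- The fine cost of a bounded quantifier: `2^{a (β n + 1)} · p(N) · (t n (2N + 2 + β n) + 1)`.
[folklore] -/
def fineCost (a : ℕ) (p : Polynomial ℕ) (β : ℕ → ℕ) (t : ℕ → ℕ → ℕ) (n N : ℕ) : ℕ :=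
  2 ^ (a * (β n + 1)) * p.eval N * (t n (2 * N + 2 + β n) + 1)

/-- The final inequality: an overhead `Q ≤ 2^{a (b+1)} p(N)` plus `2^b` runs of the matrix is
within `fineCost (a + 1) (p + 1)`. [folklore] -/
theorem fine_arith {a b pN tA Q : ℕ} (hQ : Q ≤ 2 ^ (a * (b + 1)) * pN) :
    Q + 2 ^ b * tA ≤ 2 ^ ((a + 1) * (b + 1)) * (pN + 1) * (tA + 1) := by
  have h1 : 2 ^ b ≤ 2 ^ ((a + 1) * (b + 1)) * (pN + 1) := by
    calc 2 ^ b ≤ 2 ^ ((a + 1) * (b + 1)) := Nat.pow_le_pow_right (by norm_num) (by nlinarith)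
      _ ≤ 2 ^ ((a + 1) * (b + 1)) * (pN + 1) := Nat.le_mul_of_pos_right _ (Nat.succ_pos _)
  have h2 : Q ≤ 2 ^ ((a + 1) * (b + 1)) * (pN + 1) := by
    refine hQ.trans (Nat.mul_le_mul (Nat.pow_le_pow_right (by norm_num) ?_) (Nat.le_succ _))
    exact Nat.mul_le_mul_right _ (Nat.le_succ a)
  rw [Nat.mul_add _ tA 1, Nat.mul_one, Nat.add_comm Q]
  exact Nat.add_le_add (Nat.mul_le_mul_right _ h1) h2

/-- **Bounded majority quantifier at polynomial overhead.** If `A` is decided within `t n N'`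
steps one level up and `0^{β n}` is producible in `FP`, then `BMAJ k β A` is decided within
`fineCost a p β t n N = 2^{a (β n + 1)} · p(N) · (t n (2N + 2 + β n) + 1)` steps on words of
length `N`: the fine lister, the decider of `A` on each of the `2^{β n}` entries with the
verdicts concatenated (`flatMap_outputsWithin`), and the majority of the verdict bits
(`majBitsFn`). [cite: AroraBarakCC2009, §7.1 (remark after Def. 7.3) and Lemma 20.3 (proof)] -/
theorem DecIn.bmajFine {k : ℕ} {β : ℕ → ℕ} {A : Language Bool} {t : ℕ → ℕ → ℕ}
    (hA : DecIn (k + 1) A t) (hβ : FPProducer β) :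
    ∃ (a : ℕ) (p : Polynomial ℕ), DecIn k (BMAJ k β A) (fineCost a p β t) := by
  classical
  obtain ⟨T₁, M₁, hT₁, hM₁⟩ := exists_lister_fine k hβ
  obtain ⟨MA, hMA⟩ := hA
  obtain ⟨Ms, hMs⟩ := stripT.exists_outputsWithin
  obtain ⟨p₄, M₄, hM₄⟩ := exists_outputsWithin_of_mem_FP majBitsFn_mem_FP
  let M₂ : TM2ComputableAux (Option Bool) Bool := Ms.comp MA
  let b : List Bool → ℕ := fun w => β (fstP^[k] w).length
  let L : List Bool → ℕ := fun w => 2 * w.length + 2 + b w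
  let R : List Bool → ℕ := fun w => 2 ^ b w
  let Q : List Bool → ℕ := fun w =>
    p₄.eval (R w) + (T₁ w + R w * (((stripT.maxEmit + 1) * L w + 3) + 2 * L w + 2 + 3) + 3)
  have hQ : PBnd b (fun w => w.length) Q := by
    have bc : ∀ K, PBnd b (fun w : List Bool => w.length) fun _ => K := fun K => PBnd.const K
    have bN : PBnd b (fun w : List Bool => w.length) fun w => w.length := PBnd.self_N
    have bb : PBnd b (fun w : List Bool => w.length) b := PBnd.self_b
    have bL : PBnd b (fun w : List Bool => w.length) L := (((bc 2).mul bN).add (bc 2)).add bb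
    have bR : PBnd b (fun w : List Bool => w.length) R := PBnd.two_pow 1 fun w => by simp only [b]; omega
    refine (PBnd.poly p₄ bR).add ((hT₁.add (bR.mul ?_)).add (bc 3))
    exact (((((bc _).mul bL).add (bc 3)).add ((bc 2).mul bL)).add (bc 2)).add (bc 3)
  obtain ⟨a, p, hap⟩ := hQ
  refine ⟨a + 1, p + 1, (M₁.flatMapMachine M₂ none).comp M₄, fun w => ?_⟩
  show ((M₁.flatMapMachine M₂ none).comp M₄).OutputsWithin w
    (encodeBool (Set.boolIndicator (BMAJ k β A) w))
    (fineCost (a + 1) (p + 1) β t (fstP^[k] w).length w.length)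
  set b₀ := β (fstP^[k] w).length with hb₀
  let q : ℕ → Bool := fun j => Set.boolIndicator A (boolPair w (natBits b₀ j))
  have hw : ∀ j : ℕ, (none : Option Bool) ∉ (boolPair w (natBits b₀ j)).map some := by simp
  have h₂ : ∀ j : ℕ, M₂.OutputsWithin ((boolPair w (natBits b₀ j)).map some) [q j]
      (t (fstP^[k] w).length (2 * w.length + 2 + b₀) +
        ((stripT.maxEmit + 1) * (2 * w.length + 2 + b₀) + 3)) := by
    intro j
    have hs := hMs ((boolPair w (natBits b₀ j)).map some)
    rw [stripT_eval_map_some, List.length_map, length_boolPair, length_natBits] at hs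
    have ha := hMA (boolPair w (natBits b₀ j))
    simp only [id_eq, iterate_fstP_boolPair, length_boolPair, length_natBits] at ha
    exact TM2ComputableAux.comp_outputsWithin _ _ hs ha
  have H₃ := TM2ComputableAux.flatMap_outputsWithin M₁ M₂ (sep := none) hw (hM₁ w) h₂
  rw [flatMap_singleton_eq_map] at H₃
  have H₄ := hM₄ ((List.range (R w)).map q)
  have hval : majBitsFn ((List.range (R w)).map q) = encodeBool (Set.boolIndicator (BMAJ k β A) w) := by
    have e : R w = 2 ^ b₀ * 1 := (mul_one _).symm
    rw [e]
    exact majBitsFn_verdicts (k := k) (β := β) (A := A) w le_rfl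
  rw [hval, List.length_map, List.length_range] at H₄
  have H := TM2ComputableAux.comp_outputsWithin _ _ H₃ H₄
  refine H.mono ?_
  have key := fine_arith (tA := t (fstP^[k] w).length (2 * w.length + 2 + b₀)) (hap w)
  refine le_trans (le_of_eq ?_) (key.trans (le_of_eq ?_))
  · simp only [Q, L, R, b, List.length_map, length_boolPair, length_natBits, List.length_singleton,
      mul_one, List.map_const', List.length_range, List.sum_replicate, smul_eq_mul, ← hb₀]
    ring
  · simp only [fineCost, eval_add, eval_one, b, ← hb₀]

/-- **Bounded existential quantifier at polynomial overhead** (same lister, the disjunction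
machine `any_outputsWithin` of `TM2AnyList.lean`). [cite: AroraBarakCC2009, §2.1 (exhaustive
search over all certificates) and §1.3–1.4] -/
theorem DecIn.bexFine {k : ℕ} {β : ℕ → ℕ} {A : Language Bool} {t : ℕ → ℕ → ℕ}
    (hA : DecIn (k + 1) A t) (hβ : FPProducer β) :
    ∃ (a : ℕ) (p : Polynomial ℕ), DecIn k (BEX k β A) (fineCost a p β t) := by
  classical
  obtain ⟨T₁, M₁, hT₁, hM₁⟩ := exists_lister_fine k hβ
  obtain ⟨MA, hMA⟩ := hA
  obtain ⟨Ms, hMs⟩ := stripT.exists_outputsWithin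
  let M₂ : TM2ComputableAux (Option Bool) Bool := Ms.comp MA
  let b : List Bool → ℕ := fun w => β (fstP^[k] w).length
  let L : List Bool → ℕ := fun w => 2 * w.length + 2 + b w
  let R : List Bool → ℕ := fun w => 2 ^ b w
  let Q : List Bool → ℕ := fun w =>
    T₁ w + R w * (((stripT.maxEmit + 1) * L w + 3) + 2 * L w + 3) + 2
  have hQ : PBnd b (fun w => w.length) Q := by
    have bc : ∀ K, PBnd b (fun w : List Bool => w.length) fun _ => K := fun K => PBnd.const K
    have bN : PBnd b (fun w : List Bool => w.length) fun w => w.length := PBnd.self_N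
    have bb : PBnd b (fun w : List Bool => w.length) b := PBnd.self_b
    have bL : PBnd b (fun w : List Bool => w.length) L := (((bc 2).mul bN).add (bc 2)).add bb
    have bR : PBnd b (fun w : List Bool => w.length) R := PBnd.two_pow 1 fun w => by simp only [b]; omega
    refine (hT₁.add (bR.mul ?_)).add (bc 2)
    exact ((((bc _).mul bL).add (bc 3)).add ((bc 2).mul bL)).add (bc 3)
  obtain ⟨a, p, hap⟩ := hQ
  refine ⟨a + 1, p + 1, M₁.anyMachine M₂ none, fun w => ?_⟩
  show (M₁.anyMachine M₂ none).OutputsWithin w (encodeBool (Set.boolIndicator (BEX k β A) w))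
    (fineCost (a + 1) (p + 1) β t (fstP^[k] w).length w.length)
  set b₀ := β (fstP^[k] w).length with hb₀
  have hw : ∀ j : ℕ, (none : Option Bool) ∉ (boolPair w (natBits b₀ j)).map some := by simp
  have h₂ : ∀ j : ℕ, M₂.OutputsWithin ((boolPair w (natBits b₀ j)).map some)
      [Set.boolIndicator A (boolPair w (natBits b₀ j))]
      (t (fstP^[k] w).length (2 * w.length + 2 + b₀) +
        ((stripT.maxEmit + 1) * (2 * w.length + 2 + b₀) + 3)) := by
    intro j
    have hs := hMs ((boolPair w (natBits b₀ j)).map some)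
    rw [stripT_eval_map_some, List.length_map, length_boolPair, length_natBits] at hs
    have ha := hMA (boolPair w (natBits b₀ j))
    simp only [id_eq, iterate_fstP_boolPair, length_boolPair, length_natBits] at ha
    exact TM2ComputableAux.comp_outputsWithin _ _ hs ha
  have H := TM2ComputableAux.any_outputsWithin M₁ M₂ (sep := none) hw (hM₁ w) h₂
  have e := any_range_eq_boolIndicator_BEX (k := k) (β := β) (A := A) w (R := 2 ^ b₀) le_rfl
  rw [e] at H
  refine H.mono ?_
  have key := fine_arith (tA := t (fstP^[k] w).length (2 * w.length + 2 + b₀)) (hap w)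
  refine le_trans (le_of_eq ?_) (key.trans (le_of_eq ?_))
  · simp only [Q, L, R, b, List.length_map, length_boolPair, length_natBits, List.map_const',
      List.length_range, List.sum_replicate, smul_eq_mul, ← hb₀]
    ring
  · simp only [fineCost, eval_add, eval_one, b, ← hb₀]

end Decider

end NKannan

end Literature.Computability.Complexity
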